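import Summits.AtomisticToContinuum.Crystallization.Theorems.ExcessDecayLiouvilleLatticeSumConst
import Summits.AtomisticToContinuum.Crystallization.Theorems.ExcessDecayLiouvilleHcpLiouvilleGeometry

/-!
# Route `ExcessDecayLiouville`: the self-force of an affinely displaced two-lattice (nonlinear half, VI)

Harmonic-replacement architecture for item `ExcessDecay` (stmt-AtomisticToContinuum-9334), nonlinear half.
For an affine-plus-shift background `aff` (`aff(t_m + A z) = a_m + B(t_m + A z − x₀)`, small jump
`‖a 0 − a 1‖ ≤ 1/50` and slope `‖B‖ ≤ 1/50`), the displaced pair force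
`Φ(p, q) = F((p − q) + (aff p − aff q))` (`F(x) = h(|x|²) x`) summed over the sites `q ≠ p`:

* `norm_pairForce_le`, `norm_dispForce_le` : `‖F(x)‖ ≤ 246 |x|⁻⁷` (`|x| ≥ 2/5`), `‖Φ(p,q)‖ ≤ 31488 |p−q|⁻⁷`;
* `summable_dispForce`, `norm_tsum_dispForce_far_le` : summability and the far tail
  `‖Σ'_{dist ≥ R} Φ(p,·)‖ ≤ 31488 · 1024/((23/25)³ R⁴)`;
* `dispForce_sublattice_const` : `Σ'_q Φ(p, q)` is the same for all `p` of one sublattice;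
* `tsum_dispForce_eq_sum_add` : truncation to the sites of the ball `dist · c ≤ r`:
  `Σ'_q Φ(s,q) = Σ_{q ∈ SR∖s} Φ(s,q) + tail`, `‖tail‖ ≤ 31488 · 1024/((23/25)³ (r − dist s c)⁴)`.

All `[folklore]`; helper lemmas, nothing here closes an item.
-/

noncomputable section

namespace Summit.AtomisticToContinuum.Crystallization.Theorems.ExcessDecayLiouville

open scoped BigOperators Topology InnerProductSpace RealInnerProductSpace Classical
open Literature.MathematicalPhysics.StatisticalMechanics
open Summit.AtomisticToContinuum.Crystallization.Theorems.PhononStabilityNegative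

-- Local notation: the pair force `F(x) = h(|x|²) x`.
local notation3 "𝐅[" x "]" => ((-((‖x‖ ^ 2)⁻¹) ^ 7 + ((‖x‖ ^ 2)⁻¹) ^ 4) • x)

/-! ## Pointwise bounds -/

/-- `‖F(x)‖ ≤ 246 |x|⁻⁷` for `|x| ≥ 2/5`. [folklore] -/
theorem norm_pairForce_le {x : EuclideanSpace ℝ (Fin 3)} (hx : 2 / 5 ≤ ‖x‖) : ‖𝐅[x]‖ ≤ 246 * (‖x‖⁻¹) ^ 7 := by
  have hx0 : 0 < ‖x‖ := by linarith
  rw [norm_smul, Real.norm_eq_abs]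
  have h1 : |-((‖x‖ ^ 2)⁻¹) ^ 7 + ((‖x‖ ^ 2)⁻¹) ^ 4| ≤ ((‖x‖ ^ 2)⁻¹) ^ 7 + ((‖x‖ ^ 2)⁻¹) ^ 4 := by
    refine (abs_add_le _ _).trans ?_
    rw [abs_neg, abs_of_nonneg (by positivity), abs_of_nonneg (by positivity)]
  have hinv : ‖x‖⁻¹ ≤ 5 / 2 := by rw [inv_le_comm₀ hx0 (by norm_num)]; linarith
  set y := ‖x‖⁻¹ with hy
  have hy0 : 0 ≤ y := by positivity
  have e1 : ((‖x‖ ^ 2)⁻¹) ^ 7 * ‖x‖ = y ^ 13 := by rw [hy]; field_simp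
  have e2 : ((‖x‖ ^ 2)⁻¹) ^ 4 * ‖x‖ = y ^ 7 := by rw [hy]; field_simp
  have h6 : y ^ 6 ≤ (5 / 2 : ℝ) ^ 6 := pow_le_pow_left₀ hy0 hinv 6
  calc |-((‖x‖ ^ 2)⁻¹) ^ 7 + ((‖x‖ ^ 2)⁻¹) ^ 4| * ‖x‖ ≤ (((‖x‖ ^ 2)⁻¹) ^ 7 + ((‖x‖ ^ 2)⁻¹) ^ 4) * ‖x‖ :=
        mul_le_mul_of_nonneg_right h1 (norm_nonneg _)
    _ = y ^ 6 * y ^ 7 + y ^ 7 := by rw [add_mul, e1, e2]; ring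
    _ ≤ (5 / 2 : ℝ) ^ 6 * y ^ 7 + y ^ 7 := by gcongr
    _ ≤ 246 * y ^ 7 := by nlinarith [pow_nonneg hy0 7]

section

variable {t : Fin 2 → (EuclideanSpace ℝ (Fin 3))} {A : (EuclideanSpace ℝ (Fin 3)) →L[ℝ] (EuclideanSpace ℝ (Fin 3))}
  {aff : (EuclideanSpace ℝ (Fin 3)) → (EuclideanSpace ℝ (Fin 3))} {a : Fin 2 → EuclideanSpace ℝ (Fin 3)}
  {B : (EuclideanSpace ℝ (Fin 3)) →L[ℝ] (EuclideanSpace ℝ (Fin 3))} {x₀ : EuclideanSpace ℝ (Fin 3)}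

/-- The displaced bond is at least half the bond: `‖(p−q) + (aff p − aff q)‖ ≥ ‖p−q‖/2`. [folklore] -/
theorem norm_dispBond_ge (hA : Adm₀ A) (hI : Inner₀ t A)
    (haff : ∀ (m : Fin 2) (z : EuclideanSpace ℝ (Fin 3)), z ∈ Λ₀ → aff (t m + A z) = a m + B (t m + A z - x₀))
    (ha : ‖a 0 - a 1‖ ≤ 1 / 50) (hB : ‖B‖ ≤ 1 / 50) (p q : Sites₀ t A) (hpq : (p : EuclideanSpace ℝ (Fin 3)) ≠ q) :
    ‖(p : EuclideanSpace ℝ (Fin 3)) - q‖ / 2 ≤ ‖((p : EuclideanSpace ℝ (Fin 3)) - q) + (aff p - aff q)‖ := by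
  have hd := norm_affine_sub_le (t := t) (A := A) haff p q
  have he : 23 / 25 ≤ ‖(p : EuclideanSpace ℝ (Fin 3)) - q‖ := by
    rw [← dist_eq_norm]; exact dist_sites_ge hA hI p.2 q.2 hpq
  have h1 : ‖(p : EuclideanSpace ℝ (Fin 3)) - q‖ - ‖aff p - aff q‖ ≤ ‖((p : EuclideanSpace ℝ (Fin 3)) - q) + (aff p - aff q)‖ := by
    have := norm_sub_norm_le ((p : EuclideanSpace ℝ (Fin 3)) - q) (-(aff p - aff q))
    rw [sub_neg_eq_add, norm_neg] at this
    linarith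
  have h2 : ‖aff p - aff q‖ ≤ 1 / 50 + 1 / 50 * ‖(p : EuclideanSpace ℝ (Fin 3)) - q‖ := by
    refine hd.trans ?_
    gcongr
  nlinarith

/-- **Pointwise bound of the displaced pair force**: `‖Φ(p,q)‖ ≤ 31488 |p−q|⁻⁷`. [folklore] -/
theorem norm_dispForce_le (hA : Adm₀ A) (hI : Inner₀ t A)
    (haff : ∀ (m : Fin 2) (z : EuclideanSpace ℝ (Fin 3)), z ∈ Λ₀ → aff (t m + A z) = a m + B (t m + A z - x₀))
    (ha : ‖a 0 - a 1‖ ≤ 1 / 50) (hB : ‖B‖ ≤ 1 / 50) (p q : Sites₀ t A) (hpq : (p : EuclideanSpace ℝ (Fin 3)) ≠ q) :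
    ‖𝐅[((p : EuclideanSpace ℝ (Fin 3)) - q) + (aff p - aff q)]‖ ≤ 31488 * (dist (q : EuclideanSpace ℝ (Fin 3)) p)⁻¹ ^ 7 := by
  have hge := norm_dispBond_ge hA hI haff ha hB p q hpq
  have he : 23 / 25 ≤ ‖(p : EuclideanSpace ℝ (Fin 3)) - q‖ := by
    rw [← dist_eq_norm]; exact dist_sites_ge hA hI p.2 q.2 hpq
  have hx : 2 / 5 ≤ ‖((p : EuclideanSpace ℝ (Fin 3)) - q) + (aff p - aff q)‖ := by linarith
  have h1 := norm_pairForce_le hx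
  have he0 : 0 < ‖(p : EuclideanSpace ℝ (Fin 3)) - q‖ := by linarith
  have hx0 : 0 < ‖((p : EuclideanSpace ℝ (Fin 3)) - q) + (aff p - aff q)‖ := by linarith
  have hinv : ‖((p : EuclideanSpace ℝ (Fin 3)) - q) + (aff p - aff q)‖⁻¹ ≤ 2 * ‖(p : EuclideanSpace ℝ (Fin 3)) - q‖⁻¹ := by
    rw [show 2 * ‖(p : EuclideanSpace ℝ (Fin 3)) - q‖⁻¹ = (‖(p : EuclideanSpace ℝ (Fin 3)) - q‖ / 2)⁻¹ by
      rw [inv_div]; ring]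
    exact (inv_le_inv₀ hx0 (by positivity)).2 hge
  have hdist : dist (q : EuclideanSpace ℝ (Fin 3)) p = ‖(p : EuclideanSpace ℝ (Fin 3)) - q‖ := by rw [dist_comm, dist_eq_norm]
  rw [hdist]
  calc ‖𝐅[((p : EuclideanSpace ℝ (Fin 3)) - q) + (aff p - aff q)]‖
      ≤ 246 * (‖((p : EuclideanSpace ℝ (Fin 3)) - q) + (aff p - aff q)‖⁻¹) ^ 7 := h1
    _ ≤ 246 * (2 * ‖(p : EuclideanSpace ℝ (Fin 3)) - q‖⁻¹) ^ 7 := by gcongr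
    _ = 31488 * (‖(p : EuclideanSpace ℝ (Fin 3)) - q‖⁻¹) ^ 7 := by ring

/-! ## Summability, far tail, sublattice constancy, truncation -/

/-- **The displaced self-force row is summable.** [folklore] -/
theorem summable_dispForce (hA : Adm₀ A) (hI : Inner₀ t A)
    (haff : ∀ (m : Fin 2) (z : EuclideanSpace ℝ (Fin 3)), z ∈ Λ₀ → aff (t m + A z) = a m + B (t m + A z - x₀))
    (ha : ‖a 0 - a 1‖ ≤ 1 / 50) (hB : ‖B‖ ≤ 1 / 50) (p : Sites₀ t A) :
    Summable (fun q : Sites₀ t A => (if (p : EuclideanSpace ℝ (Fin 3)) ≠ q then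
      𝐅[((p : EuclideanSpace ℝ (Fin 3)) - q) + (aff p - aff q)] else 0)) := by
  have h7 := (summable_inv_pow_seven_sites hA hI p.2).1
  refine Summable.of_norm_bounded (h7.mul_left 31488) fun q => ?_
  by_cases hpq : (p : EuclideanSpace ℝ (Fin 3)) ≠ q
  · rw [if_pos hpq, if_pos (Ne.symm hpq)]
    exact norm_dispForce_le hA hI haff ha hB p q hpq
  · rw [if_neg hpq, norm_zero]
    split_ifs <;> positivity

/-- **Far tail of the displaced self-force**: `‖Σ'_{q : R ≤ dist q p} Φ(p, q)‖ ≤ 31488 · 1024/((23/25)³R⁴)` for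
`R ≥ 23/25`. [folklore] -/
theorem norm_tsum_dispForce_far_le (hA : Adm₀ A) (hI : Inner₀ t A)
    (haff : ∀ (m : Fin 2) (z : EuclideanSpace ℝ (Fin 3)), z ∈ Λ₀ → aff (t m + A z) = a m + B (t m + A z - x₀))
    (ha : ‖a 0 - a 1‖ ≤ 1 / 50) (hB : ‖B‖ ≤ 1 / 50) (p : Sites₀ t A) {R : ℝ} (hR : 23 / 25 ≤ R)
    (U : Set (Sites₀ t A)) (hU : ∀ q ∈ U, R ≤ dist (q : EuclideanSpace ℝ (Fin 3)) p) :
    ‖∑' q : U, (if (p : EuclideanSpace ℝ (Fin 3)) ≠ (q : Sites₀ t A) then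
        𝐅[((p : EuclideanSpace ℝ (Fin 3)) - (q : Sites₀ t A)) + (aff p - aff (q : Sites₀ t A))] else 0)‖ ≤
      31488 * (1024 / ((23 / 25 : ℝ) ^ 3 * R ^ 4)) := by
  have hfar := LevelOne.summable_far hA hI (p : EuclideanSpace ℝ (Fin 3)) hR (k := 4) (by norm_num)
  have hfarle := LevelOne.tsum_far_le hA hI (p : EuclideanSpace ℝ (Fin 3)) hR (k := 4) (by norm_num)
  -- termwise domination by the far family
  have hdom : ∀ q : U, ‖(if (p : EuclideanSpace ℝ (Fin 3)) ≠ (q : Sites₀ t A) then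
      𝐅[((p : EuclideanSpace ℝ (Fin 3)) - (q : Sites₀ t A)) + (aff p - aff (q : Sites₀ t A))] else 0)‖ ≤
      31488 * (if R ≤ dist ((q : Sites₀ t A) : EuclideanSpace ℝ (Fin 3)) p then
        (dist ((q : Sites₀ t A) : EuclideanSpace ℝ (Fin 3)) p)⁻¹ ^ (4 + 3) else 0) := by
    intro q
    rw [if_pos (hU q.1 q.2)]
    by_cases hpq : (p : EuclideanSpace ℝ (Fin 3)) ≠ (q : Sites₀ t A)
    · rw [if_pos hpq]
      exact norm_dispForce_le hA hI haff ha hB p q hpq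
    · rw [if_neg hpq, norm_zero]; positivity
  have hsU : Summable fun q : U => 31488 * (if R ≤ dist ((q : Sites₀ t A) : EuclideanSpace ℝ (Fin 3)) p then
      (dist ((q : Sites₀ t A) : EuclideanSpace ℝ (Fin 3)) p)⁻¹ ^ (4 + 3) else 0) :=
    (hfar.subtype U).mul_left 31488
  calc ‖∑' q : U, (if (p : EuclideanSpace ℝ (Fin 3)) ≠ (q : Sites₀ t A) then
        𝐅[((p : EuclideanSpace ℝ (Fin 3)) - (q : Sites₀ t A)) + (aff p - aff (q : Sites₀ t A))] else 0)‖
      ≤ ∑' q : U, 31488 * (if R ≤ dist ((q : Sites₀ t A) : EuclideanSpace ℝ (Fin 3)) p then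
          (dist ((q : Sites₀ t A) : EuclideanSpace ℝ (Fin 3)) p)⁻¹ ^ (4 + 3) else 0) :=
        tsum_of_norm_bounded hsU.hasSum hdom
    _ = 31488 * ∑' q : U, (if R ≤ dist ((q : Sites₀ t A) : EuclideanSpace ℝ (Fin 3)) p then
          (dist ((q : Sites₀ t A) : EuclideanSpace ℝ (Fin 3)) p)⁻¹ ^ (4 + 3) else 0) := tsum_mul_left
    _ ≤ 31488 * (1024 / ((23 / 25 : ℝ) ^ 3 * R ^ 4)) := by
        refine mul_le_mul_of_nonneg_left (le_trans ?_ hfarle) (by norm_num)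
        exact Summable.tsum_subtype_le _ U (fun q => by positivity) hfar

/-- Lattice translations shift an affine-plus-shift field by a constant on the sites. [folklore] -/
theorem affine_translate (haff : ∀ (m : Fin 2) (z : EuclideanSpace ℝ (Fin 3)), z ∈ Λ₀ → aff (t m + A z) = a m + B (t m + A z - x₀))
    (p : Sites₀ t A) {l : EuclideanSpace ℝ (Fin 3)} (hl : l ∈ Λ₀) :
    aff ((p : EuclideanSpace ℝ (Fin 3)) + A l) = aff p + B (A l) := by
  obtain ⟨m, z, hz, hp⟩ := p.2
  have hzl : z + l ∈ Λ₀ := hcpLiouvilleLam_add_mem hz hl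
  have e : (p : EuclideanSpace ℝ (Fin 3)) + A l = t m + A (z + l) := by rw [hp, map_add]; abel
  rw [e, haff m (z + l) hzl, hp, haff m z hz]
  simp only [map_add, map_sub]
  abel

/-- **Sublattice constancy of the displaced self-force.** [folklore] -/
theorem dispForce_sublattice_const
    (haff : ∀ (m : Fin 2) (z : EuclideanSpace ℝ (Fin 3)), z ∈ Λ₀ → aff (t m + A z) = a m + B (t m + A z - x₀))
    (m : Fin 2) {z z' : EuclideanSpace ℝ (Fin 3)} (hz : z ∈ Λ₀) (hz' : z' ∈ Λ₀) :
    (∑' q : Sites₀ t A, (if t m + A z' ≠ (q : EuclideanSpace ℝ (Fin 3)) then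
        𝐅[(t m + A z' - q) + (aff (t m + A z') - aff q)] else 0)) =
      ∑' q : Sites₀ t A, (if t m + A z ≠ (q : EuclideanSpace ℝ (Fin 3)) then
        𝐅[(t m + A z - q) + (aff (t m + A z) - aff q)] else 0) := by
  refine tsum_pair_sublattice_const (t := t) (A := A)
    (fun p q => (if p ≠ q then 𝐅[(p - q) + (aff p - aff q)] else 0)) ?_ m hz hz'
  intro l hl p q
  have hp := affine_translate haff p hl
  have hq := affine_translate haff q hl
  have e1 : (p : EuclideanSpace ℝ (Fin 3)) + A l - ((q : EuclideanSpace ℝ (Fin 3)) + A l) = (p : EuclideanSpace ℝ (Fin 3)) - q := by abel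
  have e2 : aff ((p : EuclideanSpace ℝ (Fin 3)) + A l) - aff ((q : EuclideanSpace ℝ (Fin 3)) + A l) = aff p - aff q := by
    rw [hp, hq]; abel
  have e3 : ((p : EuclideanSpace ℝ (Fin 3)) + A l ≠ (q : EuclideanSpace ℝ (Fin 3)) + A l) ↔ ((p : EuclideanSpace ℝ (Fin 3)) ≠ q) :=
    not_congr ⟨fun h => add_right_cancel h, fun h => by rw [h]⟩
  simp only [e1, e2]
  by_cases h : (p : EuclideanSpace ℝ (Fin 3)) ≠ q
  · rw [if_pos (e3.2 h), if_pos h]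
  · rw [if_neg (fun h' => h (e3.1 h')), if_neg h]

/-- **Truncation of the displaced self-force to the sites of a ball**: for `s` with `1 ≤ r − dist s c`,
`Σ'_q Φ(s, q) = Σ_{q ∈ SR∖s} Φ(s, q) + tail`, `‖tail‖ ≤ 31488 · 1024/((23/25)³ (r − dist s c)⁴)`. [folklore] -/
theorem tsum_dispForce_eq_sum_add (hA : Adm₀ A) (hI : Inner₀ t A)
    (haff : ∀ (m : Fin 2) (z : EuclideanSpace ℝ (Fin 3)), z ∈ Λ₀ → aff (t m + A z) = a m + B (t m + A z - x₀))
    (ha : ‖a 0 - a 1‖ ≤ 1 / 50) (hB : ‖B‖ ≤ 1 / 50) {c : EuclideanSpace ℝ (Fin 3)} {r : ℝ}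
    (s : Sites₀ t A) (hsr : 1 ≤ r - dist (s : EuclideanSpace ℝ (Fin 3)) c)
    (SR : Finset (EuclideanSpace ℝ (Fin 3))) (hSR : ∀ x, x ∈ SR ↔ x ∈ Sites₀ t A ∧ dist x c ≤ r) :
    ∃ tail : EuclideanSpace ℝ (Fin 3), ‖tail‖ ≤ 31488 * (1024 / ((23 / 25 : ℝ) ^ 3 * (r - dist (s : EuclideanSpace ℝ (Fin 3)) c) ^ 4)) ∧
      (∑' q : Sites₀ t A, (if (s : EuclideanSpace ℝ (Fin 3)) ≠ q then
        𝐅[((s : EuclideanSpace ℝ (Fin 3)) - q) + (aff s - aff q)] else 0)) =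
      (∑ q ∈ SR.erase s, 𝐅[((s : EuclideanSpace ℝ (Fin 3)) - q) + (aff s - aff q)]) + tail := by
  classical
  have hsum := summable_dispForce hA hI haff ha hB s
  set T : Finset (Sites₀ t A) := SR.subtype (· ∈ Sites₀ t A) with hT
  have hsplit := hsum.sum_add_tsum_compl (s := T)
  set tail := ∑' x : ↑((T : Set (Sites₀ t A)))ᶜ, (if (s : EuclideanSpace ℝ (Fin 3)) ≠ ((x : Sites₀ t A) : EuclideanSpace ℝ (Fin 3)) then
      𝐅[((s : EuclideanSpace ℝ (Fin 3)) - ((x : Sites₀ t A) : EuclideanSpace ℝ (Fin 3))) + (aff s - aff (x : Sites₀ t A))] else 0)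
    with htail
  refine ⟨tail, ?_, ?_⟩
  · -- the tail: sites outside the ball are at distance ≥ r − dist s c from s
    have hR : 23 / 25 ≤ r - dist (s : EuclideanSpace ℝ (Fin 3)) c := by linarith
    refine norm_tsum_dispForce_far_le hA hI haff ha hB s hR _ fun q hq => ?_
    have hqSR : ((q : Sites₀ t A) : EuclideanSpace ℝ (Fin 3)) ∉ SR := by
      intro h
      exact hq (by rw [Finset.mem_coe, hT, Finset.mem_subtype]; exact h)
    have hqr : r < dist ((q : Sites₀ t A) : EuclideanSpace ℝ (Fin 3)) c := by
      by_contra h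
      exact hqSR ((hSR _).2 ⟨q.2, not_lt.1 h⟩)
    have := dist_triangle ((q : Sites₀ t A) : EuclideanSpace ℝ (Fin 3)) (s : EuclideanSpace ℝ (Fin 3)) c
    linarith
  · rw [← hsplit]
    congr 1
    -- the finite part is the sum over `SR.erase s`
    have hmem : ∀ x ∈ SR, x ∈ Sites₀ t A := fun x hx => ((hSR x).1 hx).1
    rw [hT, Finset.sum_subtype_of_mem (f := fun x => if (s : EuclideanSpace ℝ (Fin 3)) ≠ x then
      𝐅[((s : EuclideanSpace ℝ (Fin 3)) - x) + (aff s - aff x)] else 0) hmem]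
    have hs0 : 0 ≤ dist (s : EuclideanSpace ℝ (Fin 3)) c := dist_nonneg
    have hsSR : (s : EuclideanSpace ℝ (Fin 3)) ∈ SR := (hSR s).2 ⟨s.2, by linarith⟩
    rw [← Finset.add_sum_erase SR _ hsSR, if_neg (fun h => h rfl), zero_add]
    refine Finset.sum_congr rfl fun x hx => ?_
    rw [if_pos (Ne.symm (Finset.mem_erase.1 hx).1)]

end

end Summit.AtomisticToContinuum.Crystallization.Theorems.ExcessDecayLiouville

end
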